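/-
Copyright (c) 2026 the pub-hodgecm-mathlib formalisation cell (harness21).  Prover seat hodgecm-mathlib-K2Liu-p12 (g4): Track B «K2-LIT»,
#184♮ = hLiu418 = stmt-HodgeConjecture-24832; Road Φ of socket #41, Φ9 consumer sheet «G3-inst» (LEAD F0P6-plan (g14) BATCH #28 (1) ∕ #32 (4));
census `K2/K2Liu-p12/g4/CENSUS-G3inst-SkewCarrierBridge.K2Liu-p12-g4.md` (I-1) + (I-3).  File B1.
-/
import Summits.HodgeConjecture.HodgeConjecture.Theorems.K2LiuSiegelUnipotentLocalDefs        -- ★ Φ3b: `unipDeltaLoc v`, `mem_unipDeltaLoc_iff_isUnipM`, `IsUnipM`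
import Summits.HodgeConjecture.HodgeConjecture.Theorems.K2LiuUnipDeltaConjugationModulus      -- ★ `matS_nElem'` (+ ★ D10 `unipDeltaLocal`, ★ `nElem`, adapted blocks)
import HarnessLib

/-!
# Crux `HLiu418`, Road Φ of socket #41, «G3-inst» (I-1) + (I-3) — THE GLOBAL-COMAP `N_Δ(L⁺_v)` IS ★ D10's LOCAL `N_Δ(F_v)`, AND THE CHARACTER COORDINATE `X(n(t)) = −½·t`

Cell `hodgecm-mathlib`, crux item hLiu418 = `stmt-HodgeConjecture-24832`, route of record `HCCMUnconditional`; squad K2 ∕ K2Liu, road `K2_Liu`,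
socket #41 `sig_K2LiuSiegelEisensteinContinuation`, Road Φ; consumer = the Φ9 tie through ★ G1-close `K2LiuWhittakerDeltaEulerProduct` (local factor
`∫_{y ∈ unipDeltaLoc v} conj ψ_S(ι_v y)·Λ_{s,v}(w_Δ y) dν_v`, ★ (d1) `unipDeltaChar_locToAdelic_eq_prod`: `ψ_S(ι_v y) = ∏_{w∣v} ψ_{L,w}(tr(S_w·X(y_w)))`) and the
Skew-carrier files ★ Φ4∕Φ5∕E7∕R1 (`t ↦ φ_s(w_Δ·n(t))·ψ(−τ tr(βt))`) via file B2 ★∕📤 `K2LiuUnipDeltaLocalHaarTransport` (keyed on ANY `N′ ≤ H(F_v)` with the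
carrier of ★ D10 `unipDeltaLocal`).  THEOREMS ONLY (no `def`, no `instance`, no `notation`, no named-fact hypothesis, no `sorry`);
lane `--supports stmt-HodgeConjecture-24832` (count-neutral helper; closes no socket by itself).

THE MATHEMATICS [Kudla1994, §3], [HarrisKudlaSweet1996, §1 (1.11)–(1.12)], [MoeglinWaldspurger1995, I.2.1].
* §1 `unip_entry_iff` — the scalar identity behind the two block descriptions of the Siegel unipotent radical: with `2h = 1`,
  `(a + b = δ ∧ c + d = δ ∧ d − b = δ) ⟺ (h(a+b−c−d) = 0 ∧ h(a+b+c+d) = δ ∧ h(a−b−c+d) = δ)` (e₂-blocks vs adapted blocks `C = 0, A = 1, D = 1`).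
* §2 **`mem_unipDeltaLoc_iff_mem_unipDeltaLocal`** — at the K2Lit datum (`F = L⁺`, `E = L`, `c` = complex conjugation, `JD = hermD`): for `y ∈ H(L⁺_v)`,
  `y ∈ unipDeltaLoc L e dV hdV dW hdW v` (★ Φ3b: `unipDelta.comap (locToAdelic v)`, membership = ★ `mem_unipDeltaLoc_iff_isUnipM`: the e₂-blocks of every `y_w`)
  `⟺ y ∈ LocalSiegelDoubled.unipDeltaLocal (Fp L) L c v n` (★ D10: `adapt (matA y) = (1 t; 0 1)`, membership = ★ `mem_unipDeltaLocal_iff_blocks`) — the component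
  dictionary `(matS y)_w = y_w` is that of ★ `isSiegelDelta_iff_blocks` (`coe_localPiEquiv_apply`, `GLn.map_piEquiv_symm`).  This is the letter `hN′` of file B2.
* §3 **`toBlocks₁₂_reindex_component_nElem`** — for a `T₀`-skew `t`, the e₂-corner of the `w`-component of `n(t)` is `X(n(t)_w) = −⅟2·t_w` (★ `matS_nElem'`:
  `matS(n t) = reindex(R (1 t; 0 1) R⁻¹)`, `R = (1 1; 1 −1)`, `R(1 t; 0 1)R⁻¹ = ½(2+t, −t; t, 2−t)`); hence **`trace_mul_toBlocks₁₂_component_nElem`**: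
  `tr(S_w · X(n(t)_w)) = −⅟2 · tr(S_w t_w)` — the argument of ★ (d1)'s local character at `y = n(t)`, i.e. `conj ψ_S(ι_v n(t)) = ∏_{w∣v} ψ_{L,w}(½ tr(S_w t_w))`
  once the additive characters are unfolded (file B4).
HONEST LABEL.  Count-neutral helper; it retires nothing by itself: `HC_CM` is proved only modulo the 7 printed citations (2 remaining named inputs:
hLiu418 = `stmt-HodgeConjecture-24832`, h413 = `stmt-HodgeConjecture-24833`) until rung 0 closes.

## References
* [Kudla1994] S. S. Kudla, *Splitting metaplectic covers of dual reductive pairs*, Israel J. Math. 87 (1994): §3 (adapted blocks of the doubled space).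
* [HarrisKudlaSweet1996] M. Harris, S. Kudla, W. J. Sweet, J. AMS 9 (1996): §1 (1.11)–(1.12) (`P_Δ`, `N_Δ ≅ Herm_n`, the coordinate `n(X)`).
* [MoeglinWaldspurger1995] C. Mœglin, J.-L. Waldspurger, *Spectral decomposition and Eisenstein series* (1995): I.2.1 (`N` locally and adelically).
* [Shimura1997] G. Shimura, *Euler products and Eisenstein series*, CBMS 93 (1997): §18.1 (18.4) (the local character `ψ(tr(S·X))`).
-/

set_option autoImplicit false
-- the mandated namespace repeats the single-problem summit's segment (`HodgeConjecture.HodgeConjecture`)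
set_option linter.dupNamespace false

noncomputable section

open scoped Matrix
open NumberField IsDedekindDomain Matrix
open Literature.NumberTheory.Automorphic Literature.NumberTheory.Automorphic.UnitaryGroup Literature.NumberTheory.GaloisRepresentations
open Literature.NumberTheory.GelbartRogawski1991 Literature.NumberTheory.GelbartRogawski1991.GRConstruction
open Literature.NumberTheory.GelbartRogawski1991.AdaptedBlocks
open Literature.NumberTheory.GelbartRogawski1991.UnitaryDualPair.LocalSplitting
open Literature.NumberTheory.K2Lit Literature.NumberTheory.K2Lit.SiegelDoubled Literature.NumberTheory.K2Lit.LocalSiegelDoubled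
open Summit.HodgeConjecture.HodgeConjecture.Cruxes.HLiu418.K2LiuSiegelUnipotentLocalDefs
open Summit.HodgeConjecture.HodgeConjecture.Cruxes.HLiu418.K2LiuUnipDeltaConjugationModulus

namespace Summit.HodgeConjecture.HodgeConjecture.Cruxes.HLiu418.K2LiuUnipDeltaLocBridge

/-! ## §1 The scalar identity behind the two block descriptions -/

/-- **e₂-blocks vs adapted blocks, one entry**: in a commutative ring with `2h = 1`, `(a + b = δ ∧ c + d = δ ∧ d − b = δ) ⟺
(h(a+b−c−d) = 0 ∧ h(a+b+c+d) = δ ∧ h(a−b−c+d) = δ)`. [cite: Kudla1994, §3] -/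
theorem unip_entry_iff {K : Type*} [CommRing K] {h : K} (hh : 2 * h = 1) (a b c d δ : K) :
    (a + b = δ ∧ c + d = δ ∧ d - b = δ) ↔ (h * (a + b - c - d) = 0 ∧ h * (a + b + c + d) = δ ∧ h * (a - b - c + d) = δ) := by
  constructor
  · rintro ⟨h1, h2, h3⟩
    exact ⟨by linear_combination h * h1 - h * h2, by linear_combination h * h1 + h * h2 + δ * hh,
      by linear_combination h * h1 - h * h2 + 2 * h * h3 + δ * hh⟩
  · rintro ⟨hC, hA, hD⟩
    exact ⟨by linear_combination hC + hA - (a + b) * hh, by linear_combination -hC + hA - (c + d) * hh,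
      by linear_combination hD - hC - (d - b) * hh⟩

/-! ## §2 The global-comap `N_Δ(L⁺_v)` is ★ D10's `N_Δ(F_v)` -/

section Bridge

variable (L : Type) [Field L] [NumberField L] [IsCMField L]
variable {N M n : ℕ} (e : Fin N × Fin M ≃ Fin n)
  (dV : Fin N → L) (hdV : ∀ i, IsCMField.complexConj L (dV i) = dV i)
  (dW : Fin M → L) (hdW : ∀ i, IsCMField.complexConj L (dW i) = dW i)
  (v : HeightOneSpectrum (𝓞 (Fp L)))

/-- the component dictionary: `(matA y)_{pq,w} = (reindex e₂⁻¹ e₂⁻¹ y_w)_{pq}` (★ `matS = (localPiEquiv y)`, ★ `GLn.map_piEquiv_symm`). [cite: Kudla1994, §3] -/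
theorem reindex_component_apply_eq_matA (y : UnitaryGroup.localPi L (IsCMField.complexConj L) (n + n) (hermD L e dV hdV dW hdW) v)
    (w : UnitaryGroup.PlacesOver L v) (p q : Fin n ⊕ Fin n) :
    Matrix.reindex (GRConstruction.e₂ (n := n)).symm (GRConstruction.e₂ (n := n)).symm
        ((((y : UnitaryGroup.LocalGLPi L (n + n) v) w : GL (Fin (n + n)) (w.1.adicCompletion L)) :
          Matrix (Fin (n + n)) (Fin (n + n)) (w.1.adicCompletion L))) p q =
      matA (Fp L) L (IsCMField.complexConj L) v n y p q w := by
  have hw : (matS (Fp L) L (IsCMField.complexConj L) v n y).map (Pi.evalRingHom _ w) =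
      (((y : UnitaryGroup.LocalGLPi L (n + n) v) w : GL (Fin (n + n)) (w.1.adicCompletion L)) :
        Matrix (Fin (n + n)) (Fin (n + n)) (w.1.adicCompletion L)) := by
    rw [matS, UnitaryGroup.coe_localPiEquiv_apply]
    exact GLn.map_piEquiv_symm _ _ _ w
  rw [← hw, matA]
  rfl

omit [IsCMField L] in
/-- `(⅟2)_w` is an inverse of `2` in `L_w`. [folklore] -/
theorem two_mul_invOf_two_apply (w : UnitaryGroup.PlacesOver L v) : (2 : w.1.adicCompletion L) * (⅟(2 : LocalRing L v)) w = 1 := by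
  have h := congrFun (mul_invOf_self (2 : LocalRing L v)) w
  rw [Pi.mul_apply, Pi.one_apply] at h
  exact h

/-- **THE BRIDGE**: at the K2Lit datum, the global-comap Siegel unipotent radical ★ `unipDeltaLoc v = unipDelta.comap (locToAdelic v)` and ★ D10's local
`unipDeltaLocal` (`adapt (matA y) = (1 t; 0 1)`) have THE SAME MEMBERS (★ `mem_unipDeltaLoc_iff_isUnipM` vs ★ `mem_unipDeltaLocal_iff_blocks`, entry by entry
through §1).  This is the letter `hN′` of file B2 `K2LiuUnipDeltaLocalHaarTransport`. [cite: MoeglinWaldspurger1995, I.2.1] [cite: Kudla1994, §3] [cite: HarrisKudlaSweet1996, §1 (1.11)] -/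
theorem mem_unipDeltaLoc_iff_mem_unipDeltaLocal (y : UnitaryGroup.localPi L (IsCMField.complexConj L) (n + n) (hermD L e dV hdV dW hdW) v) :
    y ∈ unipDeltaLoc L e dV hdV dW hdW v ↔
      y ∈ LocalSiegelDoubled.unipDeltaLocal (Fp L) L (IsCMField.complexConj L) v n (JD := hermD L e dV hdV dW hdW) := by
  rw [mem_unipDeltaLoc_iff_isUnipM, LocalSiegelDoubled.mem_unipDeltaLocal_iff_blocks]
  set A := matA (Fp L) L (IsCMField.complexConj L) v n y with hA
  have hcomp := reindex_component_apply_eq_matA L e dV hdV dW hdW v y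
  have h2 := two_mul_invOf_two_apply L v
  -- entrywise scalar forms of the two systems
  have hone : ∀ (w : UnitaryGroup.PlacesOver L v) (i j : Fin n),
      (1 : Matrix (Fin n) (Fin n) (LocalRing L v)) i j w = (1 : Matrix (Fin n) (Fin n) (w.1.adicCompletion L)) i j := fun w i j => by
    by_cases hij : i = j
    · subst hij; rw [Matrix.one_apply_eq, Matrix.one_apply_eq, Pi.one_apply]
    · rw [Matrix.one_apply_ne hij, Matrix.one_apply_ne hij, Pi.zero_apply]
  constructor
  · intro hU
    refine ⟨Matrix.ext fun i j => funext fun w => ?_, Matrix.ext fun i j => funext fun w => ?_, Matrix.ext fun i j => funext fun w => ?_⟩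
    · obtain ⟨hU1, hU2, -⟩ := hU w
      have e1 := Matrix.ext_iff.mpr hU1 i j
      have e2 := Matrix.ext_iff.mpr hU2 i j
      simp only [Matrix.add_apply, Matrix.toBlocks₁₁, Matrix.toBlocks₁₂, Matrix.toBlocks₂₁, Matrix.toBlocks₂₂, Matrix.of_apply, hcomp] at e1 e2
      simp only [blkC, Matrix.smul_apply, Matrix.add_apply, Matrix.sub_apply, smul_eq_mul, Pi.mul_apply, Pi.add_apply, Pi.sub_apply,
        Matrix.toBlocks₁₁, Matrix.toBlocks₁₂, Matrix.toBlocks₂₁, Matrix.toBlocks₂₂, Matrix.of_apply, Matrix.zero_apply, Pi.zero_apply]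
      linear_combination (⅟(2 : LocalRing L v)) w * e1 - (⅟(2 : LocalRing L v)) w * e2
    · obtain ⟨hU1, hU2, -⟩ := hU w
      have e1 := Matrix.ext_iff.mpr hU1 i j
      have e2 := Matrix.ext_iff.mpr hU2 i j
      simp only [Matrix.add_apply, Matrix.toBlocks₁₁, Matrix.toBlocks₁₂, Matrix.toBlocks₂₁, Matrix.toBlocks₂₂, Matrix.of_apply, hcomp] at e1 e2
      rw [hone w i j]
      simp only [blkA, Matrix.smul_apply, Matrix.add_apply, smul_eq_mul, Pi.mul_apply, Pi.add_apply,
        Matrix.toBlocks₁₁, Matrix.toBlocks₁₂, Matrix.toBlocks₂₁, Matrix.toBlocks₂₂, Matrix.of_apply]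
      linear_combination (⅟(2 : LocalRing L v)) w * e1 + (⅟(2 : LocalRing L v)) w * e2 + (1 : Matrix (Fin n) (Fin n) (w.1.adicCompletion L)) i j * h2 w
    · obtain ⟨hU1, hU2, hU3⟩ := hU w
      have e1 := Matrix.ext_iff.mpr hU1 i j
      have e2 := Matrix.ext_iff.mpr hU2 i j
      have e3 := Matrix.ext_iff.mpr hU3 i j
      simp only [Matrix.add_apply, Matrix.sub_apply, Matrix.toBlocks₁₁, Matrix.toBlocks₁₂, Matrix.toBlocks₂₁, Matrix.toBlocks₂₂, Matrix.of_apply, hcomp]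
        at e1 e2 e3
      rw [hone w i j]
      simp only [blkD, Matrix.smul_apply, Matrix.add_apply, Matrix.sub_apply, smul_eq_mul, Pi.mul_apply, Pi.add_apply, Pi.sub_apply,
        Matrix.toBlocks₁₁, Matrix.toBlocks₁₂, Matrix.toBlocks₂₁, Matrix.toBlocks₂₂, Matrix.of_apply]
      linear_combination (⅟(2 : LocalRing L v)) w * e1 - (⅟(2 : LocalRing L v)) w * e2 + 2 * (⅟(2 : LocalRing L v)) w * e3 +
        (1 : Matrix (Fin n) (Fin n) (w.1.adicCompletion L)) i j * h2 w
  · rintro ⟨hC, hAA, hD⟩ w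
    have eC := fun i j => congrFun (Matrix.ext_iff.mpr hC i j) w
    have eA := fun i j => congrFun (Matrix.ext_iff.mpr hAA i j) w
    have eD := fun i j => congrFun (Matrix.ext_iff.mpr hD i j) w
    simp only [blkA, blkC, blkD, Matrix.smul_apply, Matrix.add_apply, Matrix.sub_apply, smul_eq_mul, Pi.mul_apply, Pi.add_apply,
      Pi.sub_apply, Matrix.toBlocks₁₁, Matrix.toBlocks₁₂, Matrix.toBlocks₂₁, Matrix.toBlocks₂₂, Matrix.of_apply, Matrix.zero_apply,
      Pi.zero_apply, hone] at eC eA eD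
    refine ⟨Matrix.ext fun i j => ?_, Matrix.ext fun i j => ?_, Matrix.ext fun i j => ?_⟩ <;>
      simp only [Matrix.add_apply, Matrix.sub_apply, Matrix.toBlocks₁₁, Matrix.toBlocks₁₂, Matrix.toBlocks₂₁, Matrix.toBlocks₂₂, Matrix.of_apply,
        hcomp]
    · linear_combination eC i j + eA i j - (A (Sum.inl i) (Sum.inl j) w + A (Sum.inl i) (Sum.inr j) w) * h2 w
    · linear_combination -(eC i j) + eA i j - (A (Sum.inr i) (Sum.inl j) w + A (Sum.inr i) (Sum.inr j) w) * h2 w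
    · linear_combination eD i j - eC i j - (A (Sum.inr i) (Sum.inr j) w - A (Sum.inl i) (Sum.inr j) w) * h2 w

/-- the same as an EQUALITY OF SUBGROUPS of `H(L⁺_v)`. [cite: MoeglinWaldspurger1995, I.2.1] [cite: Kudla1994, §3] -/
theorem unipDeltaLoc_eq_unipDeltaLocal :
    unipDeltaLoc L e dV hdV dW hdW v = LocalSiegelDoubled.unipDeltaLocal (Fp L) L (IsCMField.complexConj L) v n (JD := hermD L e dV hdV dW hdW) :=
  Subgroup.ext fun y => mem_unipDeltaLoc_iff_mem_unipDeltaLocal L e dV hdV dW hdW v y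

end Bridge

/-! ## §3 The character coordinate `X(n(t)) = −½·t` -/

section Corner

variable (F : Type) [Field F] [NumberField F] (E : Type) [Field E] [NumberField E] [Algebra F E] (c : E ≃ₐ[F] E)
  (v : HeightOneSpectrum (𝓞 F)) (n : ℕ) {T₀ : Matrix (Fin n) (Fin n) F}
  {JD : Matrix (Fin (n + n)) (Fin (n + n)) E} (hJD : JD = (gramD F n T₀).map (algebraMap F E))

include hJD in
/-- **`matS(n(t)) = reindex e₂ e₂ (½ • (2 + t, −t; t, 2 − t))`**, i.e. the e₂-corner of the matrix of `n(t)` over `E ⊗ F_v` is `−⅟2 • t`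
(★ `matS_nElem'` with `R (1 t; 0 1) R⁻¹` multiplied out, `R = (1 1; 1 −1)`, `R⁻¹ = ½R`). [cite: HarrisKudlaSweet1996, §1 (1.11)–(1.12)] [cite: Kudla1994, §3] -/
theorem toBlocks₁₂_reindex_matS_nElem {t : Matrix (Fin n) (Fin n) (LocalRing E v)}
    (ht : (t.map (conjLocal E c v))ᵀ * gramS F E v n T₀ + gramS F E v n T₀ * t = 0) :
    (Matrix.reindex (UnitaryDualPair.LocalSplitting.e₂ n).symm (UnitaryDualPair.LocalSplitting.e₂ n).symm
      (matS F E c v n (nElem F E c v n hJD t ht))).toBlocks₁₂ = -(⅟(2 : LocalRing E v) • t) := by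
  rw [matS_nElem' F E c v n hJD ht, Matrix.reindex_apply, Matrix.reindex_apply, Matrix.submatrix_submatrix, Equiv.symm_symm, Equiv.symm_comp_self,
    Matrix.submatrix_id_id, cayRinv, cayR, Matrix.mul_smul, Matrix.fromBlocks_multiply, Matrix.fromBlocks_multiply,
    Matrix.fromBlocks_smul, Matrix.toBlocks_fromBlocks₁₂]
  simp only [Matrix.one_mul, Matrix.mul_one, Matrix.mul_zero, add_zero, Matrix.mul_neg, smul_add, smul_neg]
  abel

include hJD in
/-- **THE COORDINATE OF THE LOCAL CHARACTER AT `n(t)`**: for every `w ∣ v`, the e₂-corner of the `w`-component of `n(t)` is `X(n(t)_w) = −(⅟2·t)_w`,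
the matrix ★ (d1) `unipDeltaChar_locToAdelic_eq_prod` pairs with `S_w` under the trace. [cite: Shimura1997, §18.1 (18.4)] [cite: HarrisKudlaSweet1996, §1 (1.12)] -/
theorem toBlocks₁₂_reindex_component_nElem {t : Matrix (Fin n) (Fin n) (LocalRing E v)}
    (ht : (t.map (conjLocal E c v))ᵀ * gramS F E v n T₀ + gramS F E v n T₀ * t = 0) (w : PlacesOver E v) :
    (Matrix.reindex (GRConstruction.e₂ (n := n)).symm (GRConstruction.e₂ (n := n)).symm
        ((((nElem F E c v n hJD t ht : UnitaryGroup.localPi E c (n + n) JD v) : UnitaryGroup.LocalGLPi E (n + n) v) w :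
            GL (Fin (n + n)) (w.1.adicCompletion E)) : Matrix (Fin (n + n)) (Fin (n + n)) (w.1.adicCompletion E))).toBlocks₁₂ =
      (-(⅟(2 : LocalRing E v) • t)).map (Pi.evalRingHom (fun w' : PlacesOver E v => w'.1.adicCompletion E) w) := by
  have hw : (matS F E c v n (nElem F E c v n hJD t ht)).map (Pi.evalRingHom _ w) =
      ((((nElem F E c v n hJD t ht : UnitaryGroup.localPi E c (n + n) JD v) : UnitaryGroup.LocalGLPi E (n + n) v) w :
          GL (Fin (n + n)) (w.1.adicCompletion E)) : Matrix (Fin (n + n)) (Fin (n + n)) (w.1.adicCompletion E)) := by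
    rw [matS, UnitaryGroup.coe_localPiEquiv_apply]
    exact GLn.map_piEquiv_symm _ _ _ w
  rw [← hw]
  have h := toBlocks₁₂_reindex_matS_nElem F E c v n hJD ht
  exact Matrix.ext fun i j => congrFun (Matrix.ext_iff.mpr h i j) w

include hJD in
/-- **the trace against `S_w`**: `tr(S_w · X(n(t)_w)) = −(⅟2)_w · tr(S t)_w` for any `S ∈ M_n(E ⊗ F_v)` (read `S ⊗ 1` for a rational Fourier index `S`).
[cite: Shimura1997, §18.1 (18.4)] -/
theorem trace_mul_toBlocks₁₂_component_nElem {t : Matrix (Fin n) (Fin n) (LocalRing E v)}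
    (ht : (t.map (conjLocal E c v))ᵀ * gramS F E v n T₀ + gramS F E v n T₀ * t = 0) (w : PlacesOver E v) (S : Matrix (Fin n) (Fin n) (LocalRing E v)) :
    Matrix.trace (S.map (Pi.evalRingHom (fun w' : PlacesOver E v => w'.1.adicCompletion E) w) *
        (Matrix.reindex (GRConstruction.e₂ (n := n)).symm (GRConstruction.e₂ (n := n)).symm
          ((((nElem F E c v n hJD t ht : UnitaryGroup.localPi E c (n + n) JD v) : UnitaryGroup.LocalGLPi E (n + n) v) w :
              GL (Fin (n + n)) (w.1.adicCompletion E)) : Matrix (Fin (n + n)) (Fin (n + n)) (w.1.adicCompletion E))).toBlocks₁₂) =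
      -((⅟(2 : LocalRing E v)) w * (Matrix.trace (S * t)) w) := by
  have htr : ∀ M : Matrix (Fin n) (Fin n) (LocalRing E v),
      Matrix.trace (M.map (Pi.evalRingHom (fun w' : PlacesOver E v => w'.1.adicCompletion E) w)) = (Matrix.trace M) w := fun M => by
    simp only [Matrix.trace, Matrix.diag, Matrix.map_apply, Finset.sum_apply]
    rfl
  rw [toBlocks₁₂_reindex_component_nElem F E c v n hJD ht w, ← Matrix.map_mul, htr, Matrix.mul_neg, Matrix.mul_smul, Matrix.trace_neg,
    Matrix.trace_smul, Pi.neg_apply, smul_eq_mul, Pi.mul_apply]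

end Corner

end Summit.HodgeConjecture.HodgeConjecture.Cruxes.HLiu418.K2LiuUnipDeltaLocBridge

end
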